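import Mathlib.Topology.Homotopy.Lifting
import Literature.Geometry.Kaehler.ComplexTorusHomLift
import HarnessLib

/-!
# The covering `E → E/Φ(ℤ^ι)` of a complex torus is a quotient covering by the lattice; `π₁` of the torus is the lattice

Layer `Literature/Geometry/Kaehler`, namespace `Literature.Geometry.Kaehler.ComplexTorus`; sequel of
`ComplexTorusHomLift.lean` (`ComplexTorus.isCoveringMap_cover`: `π = cover Φ : E → X = E/Φ(ℤ^ι)` is a
covering map, Lange–Birkenhake (1992), Lemma 1.1.3 (a)).  THEOREMS ONLY, no definition, no named fact.
Here the same covering is put in Mathlib's DECK-GROUP form (`IsAddQuotientCoveringMap`, J. Xu), which is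
what the monodromy isomorphism `π₁ ≅ (deck group)ᵐᵒᵖ` and the equivariant-lift lemmas of
`Literature/AlgebraicTopology/FundamentalGroup/{MonodromyNaturality,EquivariantLiftSurjective}.lean` consume:

* `coe_eq_range_latticeVec_of_mem_iff` — a subgroup `Λ ≤ E` presented by the period isomorphism `Φ`
  (`x ∈ Λ ↔ x = Φ(v)`, `v ∈ ℤ^ι`, the output shape of
  `Literature.Algebra.Module.AddSubgroup.exists_continuousLinearEquiv_of_fg_of_finrank_le`) has carrier
  `Φ(ℤ^ι) = range (latticeVec Φ)`; `cover_eq_cover_iff_sub_mem` — the fibres of `π` are the `Λ`-cosets;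
* `isAddQuotientCoveringMap_cover` — **`π : E → X` is an additive quotient covering map for any additive
  subgroup `Λ` with carrier `Φ(ℤ^ι)` acting on `E` by translations** (e.g. `ComplexTorus.periodLattice Φ`
  of `ComplexTorusChainPeriods.lean`): `π` is an open quotient map (`isOpenQuotientMap_cover`), its fibres
  are the `Λ`-cosets (`cover_eq_zero_iff`) and `Λ` is discrete (`isDiscrete_range_latticeVec`) — Mathlib's
  `IsQuotientMap.isAddQuotientCoveringMap_of_addSubgroup`;
* `nonempty_fundamentalGroup_mulEquiv` / `…_multiplicative` — hence **`π₁(X, π z) ≅ (Multiplicative Λ)ᵐᵒᵖ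
  ≅ Multiplicative Λ`** (`E` is simply connected; Mathlib `IsAddQuotientCoveringMap.fundamentalGroupEquiv`;
  Hatcher Prop. 1.40 and Example 1.13, `π₁(Tⁿ) ≅ ℤⁿ`).

Sequel: `ComplexTorusEquivariantMapFundamentalGroup.lean` (a map into the torus covered by an equivariant
map whose periods exhaust the lattice — the Albanese / period-map shape — is onto on `π₁` and injective on
`H¹(·; F)`).

## References

* [LangeBirkenhake1992] H. Lange, Ch. Birkenhake, *Complex Abelian Varieties* (1992), §1.1.1 and
  Lemma 1.1.3 (a) [corpus: book:lange1992-complex-abelian-varieties p0019].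
* [HatcherAT2002] A. Hatcher, *Algebraic Topology* (2002), Example 1.13, Prop. 1.39, Prop. 1.40.
-/

noncomputable section

open scoped Topology
open Set Function

namespace Literature.Geometry.Kaehler

namespace ComplexTorus

section Cover


variable {ι : Type*} [Fintype ι] {E : Type*} [NormedAddCommGroup E] [NormedSpace ℂ E]
  (Φ : (ι → ℝ) ≃L[ℝ] E)

omit [Fintype ι] in
/-- A subgroup presented by the period isomorphism `Φ` — `x ∈ Λ ↔ x = Φ(v)` for an integer vector `v`
(the output shape of `Literature.Algebra.Module.AddSubgroup.exists_continuousLinearEquiv_of_fg_of_finrank_le`)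
— has carrier `Φ(ℤ^ι) = range (latticeVec Φ)`. [cite: LangeBirkenhake1992, §1.1.1] -/
theorem coe_eq_range_latticeVec_of_mem_iff (Λ : AddSubgroup E)
    (h : ∀ x, x ∈ Λ ↔ ∃ v : ι → ℤ, Φ (fun i ↦ (v i : ℝ)) = x) :
    (Λ : Set E) = Set.range (latticeVec Φ) := by
  ext x
  rw [SetLike.mem_coe, h, Set.mem_range]
  rfl

omit [Fintype ι] in
/-- `π z₁ = π z₂ ↔ z₂ - z₁ ∈ Φ(ℤ^ι)` (the kernel of the covering homomorphism is the lattice,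
`cover_eq_zero_iff`). [cite: LangeBirkenhake1992, Lemma 1.1.3] -/
theorem cover_eq_cover_iff_sub_mem (Λ : AddSubgroup E) (hΛ : (Λ : Set E) = Set.range (latticeVec Φ))
    (z₁ z₂ : E) : cover Φ z₁ = cover Φ z₂ ↔ z₂ - z₁ ∈ Λ := by
  rw [← SetLike.mem_coe, hΛ, Set.mem_range, eq_comm, ← sub_eq_zero, ← cover_sub, cover_eq_zero_iff]
  exact ⟨fun ⟨n, hn⟩ ↦ ⟨n, hn.symm⟩, fun ⟨n, hn⟩ ↦ ⟨n, hn.symm⟩⟩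

/-- **`π : E → E/Φ(ℤ^ι)` is an additive quotient covering map for the lattice acting by translations**:
for any additive subgroup `Λ ≤ E` with carrier `Φ(ℤ^ι)`, `IsAddQuotientCoveringMap (cover Φ) Λ` — `π` is an
open quotient map (`isOpenQuotientMap_cover`), its fibres are the `Λ`-cosets (`cover_eq_zero_iff`) and `Λ`
is discrete (`isDiscrete_range_latticeVec`).  Lange–Birkenhake (1992), Lemma 1.1.3 (a): "the natural map
`π : V → X` may be considered as the universal covering map", in the deck-group form.
[cite: LangeBirkenhake1992, Lemma 1.1.3] -/
theorem isAddQuotientCoveringMap_cover (Λ : AddSubgroup E) (hΛ : (Λ : Set E) = Set.range (latticeVec Φ)) :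
    IsAddQuotientCoveringMap (cover Φ) Λ := by
  have hq : Topology.IsQuotientMap (cover Φ) := (isOpenQuotientMap_cover (Φ := Φ)).isQuotientMap
  have hdisc : IsDiscrete (Λ : Set E) := hΛ ▸ isDiscrete_range_latticeVec
  refine hq.isAddQuotientCoveringMap_of_addSubgroup Λ hdisc fun {z₁ z₂} ↦ ?_
  rw [cover_eq_cover_iff_sub_mem Φ Λ hΛ, sub_eq_add_neg]

/-- **`π₁(E/Φ(ℤ^ι), π z) ≅ (Multiplicative Λ)ᵐᵒᵖ`** for a subgroup `Λ` with carrier `Φ(ℤ^ι)`: the monodromy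
isomorphism of the quotient covering `π` with simply connected total space `E` (Mathlib
`IsAddQuotientCoveringMap.fundamentalGroupEquiv`). [cite: HatcherAT2002, Example 1.13 and Prop. 1.40] -/
theorem nonempty_fundamentalGroup_mulEquiv (Λ : AddSubgroup E)
    (hΛ : (Λ : Set E) = Set.range (latticeVec Φ)) (z : E) :
    Nonempty (FundamentalGroup (ComplexTorus Φ) (cover Φ z) ≃* (Multiplicative Λ)ᵐᵒᵖ) :=
  ⟨(isAddQuotientCoveringMap_cover Φ Λ hΛ).fundamentalGroupEquiv ⟨z, rfl⟩⟩

/-- Abelian form: **`π₁(E/Φ(ℤ^ι), π z) ≅ Λ`** (the opposite of a commutative group is itself).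
[cite: HatcherAT2002, Example 1.13 and Prop. 1.40] -/
theorem nonempty_fundamentalGroup_mulEquiv_multiplicative (Λ : AddSubgroup E)
    (hΛ : (Λ : Set E) = Set.range (latticeVec Φ)) (z : E) :
    Nonempty (FundamentalGroup (ComplexTorus Φ) (cover Φ z) ≃* Multiplicative Λ) :=
  ⟨((isAddQuotientCoveringMap_cover Φ Λ hΛ).fundamentalGroupEquiv ⟨z, rfl⟩).trans
    (MulOpposite.opMulEquiv (M := Multiplicative Λ)).symm⟩

end Cover

end ComplexTorus

end Literature.Geometry.Kaehler

end
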